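import Literature.IUT.HodgeArakelov.CohomologyAutKummer

/-!
# A SEMILINEAR pair `(α, β, e)` carries the Kummer class of `b` to the Kummer class of `e b` (generic; [AbsTopIII]
# Prop 3.2 / [IUTchII] Prop 3.1 (ii) shape of binder (P3) of [IUTchII] Prop 3.4 (i))

Proof-only generalisation (abc-iut cell, WAVE-5 seat abc-iut-w5-d169, holder sub-row «P34i-GENUINE-(P1)» of DAG node
IUTchII:Prop3.4(i), `plan/L6/SUBDAG-IUTchII-Prop-31-33-34.md`; GAP row G-w5d169-3) of abc-iut-w4-d043's
`CohomologyAutKummer.lean` (the automorphism pair `(α, β)` FIXES the Kummer classes when `α` lies over `G_k`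
and `β` is the identity on the coefficients — the INVERSION case) to an arbitrary automorphism pair `(α, β)` of
`(Π, G')` together with a **semilinear automorphism `e` of the constant module**: `x • e a = e (α⁻¹ x • a)` (i.e.
`e (x • a) = α x • e a`: the isomorphism of MLF-pairs `(Π ↷ A)` INDUCED by `α`) that is compatible with the cyclotome
coefficients (`c(Λ(e) ζ) = β (c ζ)`: compatibility with the cyclotomic rigidity isomorphism).  S. Mochizuki,
*Topics in absolute anabelian geometry III*, Prop. 3.2 (i), (ii), (iv) p. 71 (functoriality of `Π ↦ (Π ↷ M_TM(Π))` and of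
its Kummer map in isomorphisms of topological groups); *Inter-universal Teichmüller theory II*, kurims manuscript (Dec.
2020), Prop. 3.1 (ii) p. 88 («Ψ_cns(M^Θ_*) := M_TM(M^Θ_*) … functorial algorithm»), Prop. 3.4 (i) p. 91 («compatible
collections of isomorphisms … M_TM ⥲ M_TM»).  Claim key of the [IUTchII] interface `Mochizuki2012` (DISPUTED, D-0012);
the mathematics is transport of structure in Kummer theory [cite: NeukirchSchmidtWingberg2008, I §5].

PROVED (no definitions, no `Prop`-valued fact), over abc-iut-w4-d007's Kummer map `h1LimKummer c : A →* lim_K H¹(H ⊓ K, A')`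
(`CohomologyLimitKummer.lean`) and abc-iut-L6-t1's pair action `h1LimAut` / `h1LimAutEquiv`:
* `autMap_kummerContClass_semilinear` — at a level `K` fixing `b`, the transport along `(α, β)` of the continuous Kummer
  class of `b` (root system `x`) is the Kummer class of `e b` at level `α(K)` (root system `Λ(e) x`): the cocycle
  `y ↦ β c((α⁻¹y • x_n / x_n)_n) = c((y • e x_n / e x_n)_n)`;
* **`h1LimAut_h1LimKummer_semilinear`**, **`h1LimAutEquiv_h1LimKummer_semilinear`** — `ρ_(α,β) (κ b) = κ (e b)` in the
  limit; hence `map_mrange_h1LimKummerOn_eq_of_semilinear` — for an `e`-stable submonoid `O` (the constant monoid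
  `𝒪^▷`), `ρ_(α,β)` carries `κ(O)` ONTO itself: binder (P3) `hκ` of [IUTchII] Prop 3.4 (i) in the shape
  «`(α, e)` is an isomorphism of the pair `(Π ↷ O)` compatible with the cyclotomic rigidity» (abc-iut-w4-d043's case:
  `e = id`).
Nothing here takes a side on [IUTchIII] Cor. 3.12; typed ≠ proved.
-/

noncomputable section

namespace Literature.IUT.HodgeArakelov

open Literature.AnabelianGeometry.EtaleTheta CohomologySystemOfContH1

namespace CohomologySystemOfContH1

variable {P : TopGroup.{0}} {G' : Type} [Group G'] [TopologicalSpace G'] [IsTopologicalGroup G']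
  (φ : P →* G') (A' : Subgroup G') [A'.Normal] [IsMulCommutative A'] (H : Subgroup P)
  {A : Type} [CommGroup A] [MulDistribMulAction P A] [TopologicalSpace A]
  (c : CyclotomeCoefficients φ A' A)
  (α : P ≃ₜ* P) (β : G' ≃ₜ* G') (hφ : ∀ g, β (φ g) = φ (α g))
  (hA : ∀ a : G', a ∈ A' ↔ β a ∈ A') (hH : ∀ x, x ∈ H ↔ α x ∈ H)
  (e : A ≃* A) (he : ∀ (x : P) (a : A), x • e a = e (α.symm x • a))
  (hc : ∀ ζ : cyclotome A, ((c.hom (cyclotome.map e.toMonoidHom ζ) : A') : G') = β (c.hom ζ : G'))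

omit [TopologicalSpace A] in
include hH he in
/-- If `H ⊓ K` fixes `b`, then `H ⊓ α(K)` fixes `e b` (semilinearity). [cite: NeukirchSchmidtWingberg2008, I §5] -/
theorem mem_fixedPoints_mapAut_semilinear {K : Subgroup P} {b : A} (hb : b ∈ MulAction.fixedPoints ↥(H ⊓ K) A) :
    e b ∈ MulAction.fixedPoints ↥(H ⊓ K.map α.toMulEquiv.toMonoidHom) A := fun y => by
  change (y : P) • e b = e b
  rw [he]
  exact congrArg e (hb ⟨α.symm y, symm_mem_inf H α hH K y y.2⟩)

omit [TopologicalSpace A] in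
include he in
/-- The Kummer cocycle of the mapped root system `Λ(e) x` of `e b` at `y` is `Λ(e)` of the Kummer cocycle of `x` at
`α⁻¹ y` (componentwise `y • e x_n / e x_n = e (α⁻¹y • x_n / x_n)`). [cite: NeukirchSchmidtWingberg2008, I §5] -/
theorem kummerCocycle_map_semilinear {K : Subgroup P} {b : A} (x : RootSystem b)
    (hb : b ∈ MulAction.fixedPoints ↥(H ⊓ K) A) (y : ↥(H ⊓ K.map α.toMulEquiv.toMonoidHom)) :
    (x.map e.toMonoidHom).kummerCocycle (mem_fixedPoints_mapAut_semilinear H α hH e he hb) y =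
      cyclotome.map e.toMonoidHom (x.kummerCocycle hb ⟨α.symm (y : P), symm_mem_inf H α hH K y y.2⟩) := by
  apply Subtype.ext
  funext n
  rw [RootSystem.kummerCocycle_apply, cyclotome.map_apply, RootSystem.kummerCocycle_apply, RootSystem.map_root]
  change (y : P) • e (x.root n) / e (x.root n) = e (α.symm (y : P) • x.root n / x.root n)
  rw [map_div, he]

include he hc in
/-- **The transport along `(α, β)` of the continuous Kummer class of `b` at level `H ⊓ K` is the Kummer class of `e b`
at level `H ⊓ α(K)`** (root system `Λ(e) x`). [cite: NeukirchSchmidtWingberg2008, I §5] -/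
theorem autMap_kummerContClass_semilinear {K : Subgroup P} {b : A} (x : RootSystem b)
    (hb : b ∈ MulAction.fixedPoints ↥(H ⊓ K) A) (hx : ∀ n : ℕ+, IsOpen (MulAction.stabilizer P (x.root n) : Set P))
    (hx' : ∀ n : ℕ+, IsOpen (MulAction.stabilizer P ((x.map e.toMonoidHom).root n) : Set P)) :
    ContH1Aut.autMap φ A' α β hφ (fun a ha => (hA a).mp ha) (symm_mem_inf H α hH K)
        (c.kummerContClass (H ⊓ K) x hb hx) =
      c.kummerContClass (H ⊓ K.map α.toMulEquiv.toMonoidHom) (x.map e.toMonoidHom)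
        (mem_fixedPoints_mapAut_semilinear H α hH e he hb) hx' := by
  change QuotientGroup.mk (ContH1Aut.autCocycle φ A' α β hφ (fun a ha => (hA a).mp ha) (symm_mem_inf H α hH K)
      (c.kummerContCocycle (H ⊓ K) x hb hx)) =
    QuotientGroup.mk (c.kummerContCocycle (H ⊓ K.map α.toMulEquiv.toMonoidHom) (x.map e.toMonoidHom)
      (mem_fixedPoints_mapAut_semilinear H α hH e he hb) hx')
  congr 1
  apply Subtype.ext
  funext y
  apply Subtype.ext
  rw [ContH1Aut.coe_autCocycle_apply, CyclotomeCoefficients.kummerContCocycle_apply,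
    CyclotomeCoefficients.kummerContCocycle_apply, kummerCocycle_map_semilinear H α hH e he x hb y, hc]

variable (hopen : ∀ b : A, IsOpen (MulAction.stabilizer P b : Set P)) [RootableBy A ℕ]
  (hfi : ∀ b : A, (MulAction.stabilizer P b).FiniteIndex)

include he hc in
/-- **`ρ_(α,β) (κ b) = κ (e b)`** in `lim_K H¹(H|_K, A')`: the pair action carries the Kummer class of every constant to
the Kummer class of its image under the semilinear `e` (abc-iut-w4-d043's `h1LimAut_h1LimKummer` is the case `e = id`).
[cite: Mochizuki2012, Prop 3.1 (ii) p.88] -/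
theorem h1LimAut_h1LimKummer_semilinear (b : A) :
    h1LimAut φ A' H α β hφ (fun a ha => (hA a).mp ha) hH (Multiplicative.toAdd (h1LimKummer φ A' H c hopen hfi b)) =
      Multiplicative.toAdd (h1LimKummer φ A' H c hopen hfi (e b)) := by
  have hb := mem_fixedPoints_stabIdx H hopen hfi b
  have h1 := h1LimKummer_eq_h1Of_kummerContClass φ A' H c hopen hfi b (stabIdx hopen hfi b) hb
    (RootSystem.ofRootableBy b)
  have h2 := h1LimKummer_eq_h1Of_kummerContClass φ A' H c hopen hfi (e b) (Idx.mapAut α (stabIdx hopen hfi b))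
    (mem_fixedPoints_mapAut_semilinear H α hH e he hb) ((RootSystem.ofRootableBy b).map e.toMonoidHom)
  conv_lhs => rw [h1, toAdd_ofAdd, h1LimAut_of, toMul_ofMul,
    autMap_kummerContClass_semilinear φ A' H c α β hφ hA hH e he hc _ hb _ (fun _ => hopen _)]
  rw [h2, toAdd_ofAdd]
  rfl

include he hc in
/-- The same for abc-iut-L6-t1's additive automorphism `h1LimAutEquiv`. [cite: Mochizuki2012, Prop 3.1 (ii) p.88] -/
theorem h1LimAutEquiv_h1LimKummer_semilinear (b : A) :
    h1LimAutEquiv φ A' H α β hφ hA hH (Multiplicative.toAdd (h1LimKummer φ A' H c hopen hfi b)) =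
      Multiplicative.toAdd (h1LimKummer φ A' H c hopen hfi (e b)) := by
  rw [h1LimAutEquiv_apply]
  exact h1LimAut_h1LimKummer_semilinear φ A' H c α β hφ hA hH e he hc hopen hfi b

include he hc in
/-- Multiplicative form: `toMultiplicative ρ_(α,β) (κ b) = κ (e b)`. [cite: Mochizuki2012, Prop 3.1 (ii) p.88] -/
theorem toMultiplicative_h1LimAutEquiv_h1LimKummer_semilinear (b : A) :
    AddEquiv.toMultiplicative (h1LimAutEquiv φ A' H α β hφ hA hH) (h1LimKummer φ A' H c hopen hfi b) =
      h1LimKummer φ A' H c hopen hfi (e b) :=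
  congrArg Multiplicative.ofAdd (h1LimAutEquiv_h1LimKummer_semilinear φ A' H c α β hφ hA hH e he hc hopen hfi b)

include he hc in
/-- **Binder (P3) of [IUTchII] Prop 3.4 (i) from an isomorphism of pairs**: for a submonoid `O ≤ A` carried ONTO itself by
`e` (the constant monoid `𝒪^▷`, `e` the automorphism of `Π ↷ 𝒪^▷` induced by `α`), the pair action carries the image
`κ(O)` of abc-iut-w4-d007's `h1LimKummerOn O` onto itself. [cite: Mochizuki2012, Prop 3.4 (i) p.91] -/
theorem map_mrange_h1LimKummerOn_eq_of_semilinear (O : Submonoid A) (hO : ∀ a, a ∈ O ↔ e a ∈ O) :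
    (MonoidHom.mrange (h1LimKummerOn φ A' H c hopen hfi O)).map
        (AddEquiv.toMultiplicative (h1LimAutEquiv φ A' H α β hφ hA hH) :
          Multiplicative (h1Lim φ A' H ⊥) →* Multiplicative (h1Lim φ A' H ⊥)) =
      MonoidHom.mrange (h1LimKummerOn φ A' H c hopen hfi O) := by
  rw [mrange_h1LimKummerOn]
  ext y
  constructor
  · rintro ⟨_, ⟨a, ha, rfl⟩, rfl⟩
    exact ⟨e a, (hO a).mp ha, (toMultiplicative_h1LimAutEquiv_h1LimKummer_semilinear φ A' H c α β hφ hA hH e he hc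
      hopen hfi a).symm⟩
  · rintro ⟨a, ha, rfl⟩
    refine ⟨h1LimKummer φ A' H c hopen hfi (e.symm a), ⟨e.symm a, ?_, rfl⟩, ?_⟩
    · exact (hO _).mpr (by rw [MulEquiv.apply_symm_apply]; exact ha)
    · change AddEquiv.toMultiplicative (h1LimAutEquiv φ A' H α β hφ hA hH) (h1LimKummer φ A' H c hopen hfi (e.symm a)) = _
      rw [toMultiplicative_h1LimAutEquiv_h1LimKummer_semilinear φ A' H c α β hφ hA hH e he hc hopen hfi,
        MulEquiv.apply_symm_apply]

end CohomologySystemOfContH1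

end Literature.IUT.HodgeArakelov

end
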